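import Mathlib
import Summits.ValiantsHypothesis.ValiantsHypothesis.Theorems.NewtonUnitEquationsTwoProductsFormalLogLinearisationDefs

/-!
# Crux `TwoProducts` (stmt-ValiantsHypothesis-5906), line `formal-log-linearisation`: `LiftedPencilCount` at `m = 2`

The theory memo `memo-logSumEngine-core.md` (val-width-0318-p2, evidence n°45 on 5906) reduces the line's open engine
`LogSumEngine` to the study of the LIFTED unequal-moment function of two `m`-point configurations `A, B ⊂ ℂ^s`,
`G μ = Σ_j A_j^μ − Σ_j B_j^μ`, and asks for the number of PENCIL-VISIBLE multi-indices (`G μ ≠ 0` and `μ` the strict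
minimiser of a positive grading `θ₁ + c θ₂` over `{G ≠ 0}`); `LiftedPencilCount` (`≤ 2^(a m)(s+2)^b`) is a tree-certified
necessary condition of the crux (`liftedPencilCount_of_twoProducts`).  The memo lists `m = 2, s → ∞` as the SMALLEST
OPEN INSTANCE ("two points against two points in `ℂ^s`: is the pencil-visible count `O(s)`?").

Polynomiality in `s` for `m ≤ 3` is in the tree by a different route (`liftedPencilCount_le_three`, val-lit-p4 g10,
`…FormalLogLinearisationLiftedSupportTwo.lean`: hyperbolic cross `∏(μ_i+1) ≤ 2m` ⇒ support `≤ 2`, then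
Eisenbrand–Pach–Rothvoß–Sopher, `O(s^{4/3})`).  This file gives the complementary STRUCTURAL statement at `m = 2`, self-contained
(no box lemma, no pencil — componentwise minimality suffices), with the explicit count `(s+2)^2`:

* `minimal_totalDegree_le_two` — for two points against two points, every componentwise-MINIMAL element `μ` of
  `{G ≠ 0}` (`G μ ≠ 0` and `G ν = 0` for all `ν < μ`) has total degree `|μ| ≤ 2`.

  Proof.  If `|μ| ≥ 2`, minimality kills every unit vector of the support, so the first moments agree on `supp μ` and the
  four points are a PARALLELOGRAM there: `B₀ = A₀ + u`, `B₁ = A₀ + v`, `A₁ = A₀ + u + v`, whence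
  `G(e_i + e_k) = u_i v_k + u_k v_i` and `G(2e_i) = 2 u_i v_i`.  If `|μ| ≥ 3` all these vanish on `supp μ` too, and:
  a support coordinate with `u_k = v_k = 0` is impossible (`G μ = c^{μ_k} G(μ − μ_k e_k)`); a support coordinate with
  `u_i v_i ≠ 0` forces every support coordinate to be of that kind with `|supp μ| = |μ| ≥ 3`, and three of them satisfy
  `2 u_k u_l v_i = u_k R(i,l) + u_l R(i,k) − u_i R(k,l) = 0` — impossible; so each support coordinate has exactly one of
  `u, v` nonzero, mixed kinds contradict `u_i v_k = 0`, and a pure kind gives `A₀^μ = B₁^μ, A₁^μ = B₀^μ` (or the other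
  pairing), i.e. `G μ = 0`.

* `liftedPencilCount_two` — the memo's `LiftedPencilCount` body with `m` fixed to `2` and the explicit bound
  `#S ≤ (s + 2)^2` (pencil-visible ⇒ componentwise-minimal ⇒ `|μ| ≤ 2` ⇒ `μ = [e_x] + [e_y]` for a pair in
  `Fin (s+1) × Fin (s+1)`).

Honest framing: an UNCONDITIONAL, Mathlib-only algebraic theorem about the engine's LIFTED NECESSARY condition at `m = 2`; it
does NOT bound the engine (the fibre-cancellation half of the memo is untouched) and says nothing for `m ≥ 3`; the engine
`LogSumEngine` and the crux `TwoProducts` are OPEN; nothing here bears on `VP ≠ VNP`.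
-/

set_option linter.dupNamespace false

noncomputable section

open scoped BigOperators

namespace Summit.ValiantsHypothesis.ValiantsHypothesis.Theorems.NewtonUnitEquations.TwoProducts.FormalLogLinearisation

/-! ## Monomial bookkeeping on `Fin s → ℕ` -/

/-- `X^{n e_i} = X_i^n`. [folklore] -/
theorem prod_pow_single {s : ℕ} (X : Fin s → ℂ) (i : Fin s) (n : ℕ) :
    ∏ l, X l ^ (Pi.single i n : Fin s → ℕ) l = X i ^ n := by
  classical
  rw [Finset.prod_eq_single i (fun l _ hl => by rw [Pi.single_eq_of_ne hl, pow_zero])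
    (fun h => absurd (Finset.mem_univ i) h), Pi.single_eq_same]

/-- `X^{f + g} = X^f · X^g`. [folklore] -/
theorem prod_pow_add' {s : ℕ} (X : Fin s → ℂ) (f g : Fin s → ℕ) :
    ∏ l, X l ^ (f + g) l = (∏ l, X l ^ f l) * ∏ l, X l ^ g l := by
  rw [← Finset.prod_mul_distrib]
  exact Finset.prod_congr rfl fun l _ => by rw [Pi.add_apply, pow_add]

/-- `X^μ = X_k^{μ_k} · X^{μ − μ_k e_k}`. [folklore] -/
theorem prod_pow_update_zero {s : ℕ} (X : Fin s → ℂ) (μ : Fin s → ℕ) (k : Fin s) :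
    ∏ l, X l ^ μ l = X k ^ μ k * ∏ l, X l ^ (Function.update μ k 0) l := by
  classical
  have h : μ = Function.update μ k 0 + Pi.single k (μ k) := by
    funext l
    by_cases hl : l = k
    · subst hl; simp
    · simp [Function.update_of_ne hl, Pi.single_eq_of_ne hl]
  conv_lhs => rw [h]
  rw [prod_pow_add', prod_pow_single, mul_comm]

/-- `X^μ` only depends on the values of `X` on the support of `μ`. [folklore] -/
theorem prod_pow_congr_support {s : ℕ} (X Y : Fin s → ℂ) (μ : Fin s → ℕ) (h : ∀ l, μ l ≠ 0 → X l = Y l) :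
    ∏ l, X l ^ μ l = ∏ l, Y l ^ μ l := by
  refine Finset.prod_congr rfl fun l _ => ?_
  by_cases hl : μ l = 0
  · rw [hl, pow_zero, pow_zero]
  · rw [h l hl]

/-- A unit vector inside the support lies below `μ`. [folklore] -/
theorem single_one_le {s : ℕ} (μ : Fin s → ℕ) (i : Fin s) (hi : μ i ≠ 0) : (Pi.single i 1 : Fin s → ℕ) ≤ μ := by
  intro l
  rw [Pi.single_apply]
  by_cases hl : l = i
  · rw [if_pos hl]; subst hl; exact Nat.one_le_iff_ne_zero.mpr hi
  · rw [if_neg hl]; exact Nat.zero_le _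

/-! ## The structural theorem: minimal elements of `{G ≠ 0}` have total degree `≤ 2` (two points against two points) -/

/-- **Componentwise-minimal elements of `{G ≠ 0}` have total degree `≤ 2` for `m = 2`.**  For `A, B : Fin 2 → Fin s → ℂ`
and `G μ = Σ_j ∏_i A j i ^ μ i − Σ_j ∏_i B j i ^ μ i`: if `G μ ≠ 0` and `G ν = 0` for every `ν ≤ μ`, `ν ≠ μ`, then
`Σ_i μ i ≤ 2`. [folklore] -/
theorem minimal_totalDegree_le_two {s : ℕ} (A B : Fin 2 → Fin s → ℂ) (μ : Fin s → ℕ)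
    (hG : (∑ j, ∏ i, A j i ^ μ i) ≠ (∑ j, ∏ i, B j i ^ μ i))
    (hmin : ∀ ν : Fin s → ℕ, ν ≤ μ → ν ≠ μ → (∑ j, ∏ i, A j i ^ ν i) = (∑ j, ∏ i, B j i ^ ν i)) :
    ∑ i, μ i ≤ 2 := by
  classical
  by_contra h3
  push Not at h3
  simp only [Fin.sum_univ_two] at hG hmin
  have hne_of_sum : ∀ ν : Fin s → ℕ, ∑ l, ν l < ∑ l, μ l → ν ≠ μ := fun ν h e => by rw [e] at h; exact lt_irrefl _ h
  -- (1) unit vectors of the support are dead: first moments agree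
  have E1 : ∀ i, μ i ≠ 0 → A 0 i + A 1 i = B 0 i + B 1 i := by
    intro i hi
    have h := hmin (Pi.single i 1) (single_one_le μ i hi)
      (hne_of_sum _ (by rw [Fintype.sum_pi_single']; omega))
    simpa [prod_pow_single] using h
  -- (2) degree-two points of the support are dead
  have E2 : ∀ i k, μ i ≠ 0 → μ k ≠ 0 → i ≠ k → A 0 i * A 0 k + A 1 i * A 1 k = B 0 i * B 0 k + B 1 i * B 1 k := by
    intro i k hi hk hik
    have hle : (Pi.single i 1 + Pi.single k 1 : Fin s → ℕ) ≤ μ := by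
      intro l
      rw [Pi.add_apply, Pi.single_apply, Pi.single_apply]
      by_cases hli : l = i
      · rw [if_pos hli, if_neg (fun h => hik (hli.symm.trans h))]
        subst hli
        have := Nat.one_le_iff_ne_zero.mpr hi
        omega
      · rw [if_neg hli]
        by_cases hlk : l = k
        · rw [if_pos hlk]
          subst hlk
          have := Nat.one_le_iff_ne_zero.mpr hk
          omega
        · rw [if_neg hlk]; exact Nat.zero_le _
    have h := hmin _ hle (hne_of_sum _ (by
      simp only [Pi.add_apply]
      rw [Finset.sum_add_distrib, Fintype.sum_pi_single', Fintype.sum_pi_single']; omega))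
    simp only [prod_pow_add', prod_pow_single, pow_one] at h
    exact h
  have E3 : ∀ i, 2 ≤ μ i → A 0 i ^ 2 + A 1 i ^ 2 = B 0 i ^ 2 + B 1 i ^ 2 := by
    intro i hi
    have hle : (Pi.single i 2 : Fin s → ℕ) ≤ μ := by
      intro l
      rw [Pi.single_apply]
      by_cases hl : l = i
      · rw [if_pos hl]; subst hl; exact hi
      · rw [if_neg hl]; exact Nat.zero_le _
    have h := hmin _ hle (hne_of_sum _ (by rw [Fintype.sum_pi_single']; omega))
    simpa [prod_pow_single] using h
  -- parallelogram coordinates `u = B₀ − A₀`, `v = B₁ − A₀` on the support: `A₁ = A₀ + u + v`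
  have hA1 : ∀ i, μ i ≠ 0 → A 1 i = B 0 i + B 1 i - A 0 i := fun i hi => by
    have := E1 i hi; linear_combination this
  -- pair relation `R(i,k)`: `u_i v_k + u_k v_i = 0`, and `u_i v_i = 0` when `μ i ≥ 2`
  have R : ∀ i k, μ i ≠ 0 → μ k ≠ 0 → i ≠ k →
      (B 0 i - A 0 i) * (B 1 k - A 0 k) + (B 0 k - A 0 k) * (B 1 i - A 0 i) = 0 := by
    intro i k hi hk hik
    have h := E2 i k hi hk hik
    rw [hA1 i hi, hA1 k hk] at h
    linear_combination h
  have R2 : ∀ i, 2 ≤ μ i → (B 0 i - A 0 i) * (B 1 i - A 0 i) = 0 := by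
    intro i hi
    have h := E3 i hi
    rw [hA1 i (by omega)] at h
    linear_combination h / 2
  -- (3) no constant coordinate in the support
  have hconst : ∀ k, μ k ≠ 0 → ¬ (B 0 k = A 0 k ∧ B 1 k = A 0 k) := by
    rintro k hk ⟨hu, hv⟩
    have hA1k : A 1 k = A 0 k := by rw [hA1 k hk, hu, hv]; ring
    set μ' := Function.update μ k 0 with hμ'
    have hle : μ' ≤ μ := fun l => by
      by_cases hl : l = k
      · subst hl; rw [hμ', Function.update_self]; exact Nat.zero_le _
      · rw [hμ', Function.update_of_ne hl]
    have hne : μ' ≠ μ := fun e => hk (by have := congrFun e k; rw [hμ', Function.update_self] at this; exact this.symm)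
    have h := hmin μ' hle hne
    apply hG
    rw [prod_pow_update_zero (A 0) μ k, prod_pow_update_zero (A 1) μ k, prod_pow_update_zero (B 0) μ k,
      prod_pow_update_zero (B 1) μ k, hA1k, hu, hv, ← mul_add, ← mul_add, h]
  -- (4) no support coordinate with `u_i ≠ 0` and `v_i ≠ 0`
  have hboth : ∀ i, μ i ≠ 0 → ¬ (B 0 i - A 0 i ≠ 0 ∧ B 1 i - A 0 i ≠ 0) := by
    rintro i hi ⟨hui, hvi⟩
    -- `μ i = 1`
    have hμi : μ i = 1 := by
      by_contra hne
      exact (mul_ne_zero hui hvi) (R2 i (by omega))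
    -- every other support coordinate is of the same kind
    have hkind : ∀ k, μ k ≠ 0 → k ≠ i → B 0 k - A 0 k ≠ 0 ∧ B 1 k - A 0 k ≠ 0 := by
      intro k hk hki
      have hRik := R i k hi hk (Ne.symm hki)
      have hnc := hconst k hk
      by_cases huk : B 0 k - A 0 k = 0
      · have hvk : B 1 k - A 0 k = 0 := by
          rw [huk, zero_mul, add_zero] at hRik
          exact (mul_eq_zero.mp hRik).resolve_left hui
        exact absurd ⟨by linear_combination huk, by linear_combination hvk⟩ hnc
      · refine ⟨huk, fun hvk => ?_⟩
        rw [hvk, mul_zero, zero_add] at hRik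
        exact (mul_eq_zero.mp hRik).elim huk hvi
    have hall1 : ∀ k, μ k ≠ 0 → μ k = 1 := by
      intro k hk
      by_cases hki : k = i
      · rw [hki]; exact hμi
      · obtain ⟨huk, hvk⟩ := hkind k hk hki
        by_contra hne
        exact (mul_ne_zero huk hvk) (R2 k (by omega))
    -- three distinct support coordinates
    have hsum_le : ∀ k, μ k ≤ 1 := fun k => by
      by_cases hk : μ k = 0
      · omega
      · exact (hall1 k hk).le
    obtain ⟨k, hk, hki⟩ : ∃ k, μ k ≠ 0 ∧ k ≠ i := by
      by_contra hno
      push Not at hno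
      have : ∑ l, μ l ≤ 1 := by
        calc ∑ l, μ l = ∑ l, (if l = i then μ l else 0) :=
              Finset.sum_congr rfl fun l _ => by
                by_cases hl : l = i
                · rw [if_pos hl]
                · rw [if_neg hl]; by_contra h0; exact hl (hno l h0)
          _ = μ i := Finset.sum_ite_eq' Finset.univ i μ ▸ by simp
          _ ≤ 1 := hsum_le i
      omega
    obtain ⟨l, hl, hli, hlk⟩ : ∃ l, μ l ≠ 0 ∧ l ≠ i ∧ l ≠ k := by
      by_contra hno
      push Not at hno
      have : ∑ x, μ x ≤ 2 := by
        calc ∑ x, μ x = ∑ x, ((if x = i then μ x else 0) + (if x = k then μ x else 0)) :=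
              Finset.sum_congr rfl fun x _ => by
                by_cases hxi : x = i
                · subst hxi; rw [if_pos rfl, if_neg (Ne.symm hki), add_zero]
                · by_cases hxk : x = k
                  · subst hxk; rw [if_neg hxi, if_pos rfl, zero_add]
                  · rw [if_neg hxi, if_neg hxk, add_zero]
                    by_contra h0; exact hxk (hno x h0 hxi)
          _ = μ i + μ k := by
              rw [Finset.sum_add_distrib, Finset.sum_ite_eq' Finset.univ i μ, Finset.sum_ite_eq' Finset.univ k μ]
              simp
          _ ≤ 2 := by linarith [hsum_le i, hsum_le k]
      omega
    obtain ⟨huk, hvk⟩ := hkind k hk hki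
    obtain ⟨hul, hvl⟩ := hkind l hl hli
    have Rik := R i k hi hk (Ne.symm hki)
    have Ril := R i l hi hl (Ne.symm hli)
    have Rkl := R k l hk hl (Ne.symm hlk)
    have key : (2 : ℂ) * ((B 0 k - A 0 k) * (B 0 l - A 0 l) * (B 1 i - A 0 i)) = 0 := by
      linear_combination (B 0 k - A 0 k) * Ril + (B 0 l - A 0 l) * Rik - (B 0 i - A 0 i) * Rkl
    have h2 : (2 : ℂ) ≠ 0 := by norm_num
    exact (mul_ne_zero h2 (mul_ne_zero (mul_ne_zero huk hul) hvi)) key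
  -- (5) each support coordinate has exactly one of `u`, `v` nonzero; kinds do not mix
  have hkind' : ∀ i, μ i ≠ 0 →
      (B 0 i - A 0 i ≠ 0 ∧ B 1 i - A 0 i = 0) ∨ (B 0 i - A 0 i = 0 ∧ B 1 i - A 0 i ≠ 0) := by
    intro i hi
    by_cases hu : B 0 i - A 0 i = 0
    · by_cases hv : B 1 i - A 0 i = 0
      · exact absurd ⟨by linear_combination hu, by linear_combination hv⟩ (hconst i hi)
      · exact Or.inr ⟨hu, hv⟩
    · by_cases hv : B 1 i - A 0 i = 0
      · exact Or.inl ⟨hu, hv⟩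
      · exact absurd ⟨hu, hv⟩ (hboth i hi)
  have hnomix : ∀ i k, μ i ≠ 0 → μ k ≠ 0 → B 0 i - A 0 i ≠ 0 → B 1 k - A 0 k ≠ 0 → False := by
    intro i k hi hk hui hvk
    have hik : i ≠ k := by
      rintro rfl
      rcases hkind' i hi with ⟨-, hv⟩ | ⟨hu, -⟩
      · exact hvk hv
      · exact hui hu
    have hvi : B 1 i - A 0 i = 0 := by
      rcases hkind' i hi with ⟨-, hv⟩ | ⟨hu, -⟩
      · exact hv
      · exact absurd hu hui
    have huk : B 0 k - A 0 k = 0 := by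
      rcases hkind' k hk with ⟨-, hv⟩ | ⟨hu, -⟩
      · exact absurd hv hvk
      · exact hu
    have h := R i k hi hk hik
    rw [hvi, mul_zero, add_zero] at h
    exact (mul_ne_zero hui hvk) h
  -- (6) a pure kind makes `G μ = 0`
  rcases Nat.eq_zero_or_pos (∑ l, μ l) with h0 | hpos
  · omega
  obtain ⟨i₀, -, hi₀⟩ := Finset.exists_ne_zero_of_sum_ne_zero (by omega : (∑ l, μ l) ≠ 0)
  rcases hkind' i₀ hi₀ with ⟨hu₀, -⟩ | ⟨-, hv₀⟩
  · -- every support coordinate has `v = 0` (else mixing): `B₁ = A₀` and `A₁ = B₀` on the support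
    have hv : ∀ k, μ k ≠ 0 → B 1 k = A 0 k := fun k hk => by
      by_contra hne
      exact hnomix i₀ k hi₀ hk hu₀ (sub_ne_zero.mpr hne)
    have hA1' : ∀ k, μ k ≠ 0 → A 1 k = B 0 k := fun k hk => by rw [hA1 k hk, hv k hk]; ring
    apply hG
    rw [prod_pow_congr_support (A 0) (B 1) μ (fun l hl => (hv l hl).symm),
      prod_pow_congr_support (A 1) (B 0) μ hA1', add_comm]
  · have hu : ∀ k, μ k ≠ 0 → B 0 k = A 0 k := fun k hk => by
      by_contra hne
      exact hnomix k i₀ hk hi₀ (sub_ne_zero.mpr hne) hv₀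
    have hA1' : ∀ k, μ k ≠ 0 → A 1 k = B 1 k := fun k hk => by rw [hA1 k hk, hu k hk]; ring
    apply hG
    rw [prod_pow_congr_support (A 0) (B 0) μ (fun l hl => (hu l hl).symm), prod_pow_congr_support (A 1) (B 1) μ hA1']

/-! ## The count at `m = 2` -/

/-- Multi-indices of total degree `≤ 2` are sums of at most two unit vectors: the image of `Fin (s+1) × Fin (s+1)` under
`(x, y) ↦ [e_x] + [e_y]` (index `s` = no vector) contains them. [folklore] -/
theorem mem_image_pairs_of_sum_le_two {s : ℕ} (μ : Fin s → ℕ) (hμ : ∑ i, μ i ≤ 2) :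
    μ ∈ (Finset.univ : Finset (Fin (s + 1) × Fin (s + 1))).image (fun p =>
      (if h : (p.1 : ℕ) < s then (Pi.single ⟨p.1, h⟩ 1 : Fin s → ℕ) else 0) +
      (if h : (p.2 : ℕ) < s then (Pi.single ⟨p.2, h⟩ 1 : Fin s → ℕ) else 0)) := by
  classical
  rw [Finset.mem_image]
  -- peel off one unit vector at a time
  have peel : ∀ ν : Fin s → ℕ, (∑ i, ν i) ≠ 0 →
      ∃ i, ν i ≠ 0 ∧ ∑ l, (Function.update ν i (ν i - 1)) l + 1 = ∑ l, ν l := by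
    intro ν hν
    obtain ⟨i, -, hi⟩ := Finset.exists_ne_zero_of_sum_ne_zero hν
    refine ⟨i, hi, ?_⟩
    have h1 : ∑ l, ν l = ν i + ∑ l ∈ Finset.univ.erase i, ν l :=
      (Finset.add_sum_erase _ _ (Finset.mem_univ i)).symm
    have h2 : ∑ l, Function.update ν i (ν i - 1) l =
        (ν i - 1) + ∑ l ∈ Finset.univ.erase i, Function.update ν i (ν i - 1) l := by
      rw [← Finset.add_sum_erase _ _ (Finset.mem_univ i), Function.update_self]
    have h3 : ∑ l ∈ Finset.univ.erase i, Function.update ν i (ν i - 1) l = ∑ l ∈ Finset.univ.erase i, ν l :=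
      Finset.sum_congr rfl fun l hl => by rw [Function.update_of_ne (Finset.ne_of_mem_erase hl)]
    rw [h2, h3, h1]; omega
  -- the index of a unit vector in `Fin (s+1)`, and the "none" index `s`
  have idx : ∀ i : Fin s, (if h : ((Fin.castSucc i : Fin (s + 1)) : ℕ) < s then
      (Pi.single ⟨(Fin.castSucc i : Fin (s+1)), h⟩ 1 : Fin s → ℕ) else 0) = Pi.single i 1 := by
    intro i
    rw [dif_pos (by simp)]
    congr 1
  have none : (if h : ((Fin.last s : Fin (s + 1)) : ℕ) < s then
      (Pi.single ⟨(Fin.last s : Fin (s+1)), h⟩ 1 : Fin s → ℕ) else 0) = 0 := by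
    rw [dif_neg (by simp)]
  rcases Nat.eq_zero_or_pos (∑ i, μ i) with h0 | h1
  · -- `μ = 0`
    have hμ0 : μ = 0 := by
      funext i
      have := Finset.sum_eq_zero_iff.mp h0 i (Finset.mem_univ i)
      simpa using this
    exact ⟨(Fin.last s, Fin.last s), Finset.mem_univ _, by rw [none, add_zero, hμ0]⟩
  · obtain ⟨i, hi, hsum⟩ := peel μ (by omega)
    set ν := Function.update μ i (μ i - 1) with hν
    have hμν : μ = ν + Pi.single i 1 := by
      funext l
      by_cases hl : l = i
      · subst hl; rw [Pi.add_apply, hν, Function.update_self, Pi.single_eq_same]; omega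
      · rw [Pi.add_apply, hν, Function.update_of_ne hl, Pi.single_eq_of_ne hl, add_zero]
    rcases Nat.eq_zero_or_pos (∑ l, ν l) with hν0 | hν1
    · have hν0' : ν = 0 := by
        funext l
        have := Finset.sum_eq_zero_iff.mp hν0 l (Finset.mem_univ l)
        simpa using this
      refine ⟨(Fin.castSucc i, Fin.last s), Finset.mem_univ _, ?_⟩
      rw [idx, none, add_zero, hμν, hν0', zero_add]
    · obtain ⟨k, hk, hsum'⟩ := peel ν (by omega)
      set ρ := Function.update ν k (ν k - 1) with hρ
      have hνρ : ν = ρ + Pi.single k 1 := by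
        funext l
        by_cases hl : l = k
        · subst hl; rw [Pi.add_apply, hρ, Function.update_self, Pi.single_eq_same]; omega
        · rw [Pi.add_apply, hρ, Function.update_of_ne hl, Pi.single_eq_of_ne hl, add_zero]
      have hρ0 : ∑ l, ρ l = 0 := by omega
      have hρ0' : ρ = 0 := by
        funext l
        have := Finset.sum_eq_zero_iff.mp hρ0 l (Finset.mem_univ l)
        simpa using this
      refine ⟨(Fin.castSucc k, Fin.castSucc i), Finset.mem_univ _, ?_⟩
      rw [idx, idx, hμν, hνρ, hρ0', zero_add]

/-- **`LiftedPencilCount` at `m = 2`, with the explicit bound `(s+2)^2`.**  For two points against two points in `ℂ^s`,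
every finite set of pencil-visible multi-indices (for any 2-pencil of positive real gradings) has at most `(s+2)^2`
elements — the memo's `LiftedPencilCount` body with `m` specialised to `2` and constants `a = 0, b = 2` made explicit
(`(s+2)^2 = 2^(0·2)·(s+2)^2`). [folklore] -/
theorem liftedPencilCount_two {s : ℕ} (A B : Fin 2 → Fin s → ℂ) (θ₁ θ₂ : Fin s → ℝ)
    (hθ₁ : ∀ i, 0 < θ₁ i) (hθ₂ : ∀ i, 0 < θ₂ i) (S : Finset (Fin s → ℕ))
    (hS : ∀ μ ∈ S, (∑ j, ∏ i, A j i ^ μ i) ≠ (∑ j, ∏ i, B j i ^ μ i) ∧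
      ∃ c : ℝ, 0 < c ∧ ∀ ν : Fin s → ℕ, ν ≠ μ →
        (∑ j, ∏ i, A j i ^ ν i) ≠ (∑ j, ∏ i, B j i ^ ν i) →
          ∑ i, (θ₁ i + c * θ₂ i) * (μ i : ℝ) < ∑ i, (θ₁ i + c * θ₂ i) * (ν i : ℝ)) :
    S.card ≤ (s + 2) ^ 2 := by
  classical
  -- pencil-visible ⇒ componentwise-minimal ⇒ total degree ≤ 2
  have hdeg : ∀ μ ∈ S, ∑ i, μ i ≤ 2 := by
    intro μ hμ
    obtain ⟨hG, c, hc, hmin⟩ := hS μ hμ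
    refine minimal_totalDegree_le_two A B μ hG fun ν hle hne => ?_
    by_contra hGν
    have hlt := hmin ν hne hGν
    -- but `ν ≤ μ` makes `ν` lighter for the positive grading
    have hle' : ∑ i, (θ₁ i + c * θ₂ i) * (ν i : ℝ) ≤ ∑ i, (θ₁ i + c * θ₂ i) * (μ i : ℝ) :=
      Finset.sum_le_sum fun i _ => by
        have h1 : (0 : ℝ) ≤ θ₁ i + c * θ₂ i := by have := hθ₁ i; have := hθ₂ i; positivity
        have h2 : (ν i : ℝ) ≤ (μ i : ℝ) := by exact_mod_cast hle i
        exact mul_le_mul_of_nonneg_left h2 h1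
    linarith
  -- inject into `Fin (s+1) × Fin (s+1)`
  calc S.card ≤ ((Finset.univ : Finset (Fin (s + 1) × Fin (s + 1))).image (fun p =>
        (if h : (p.1 : ℕ) < s then (Pi.single ⟨p.1, h⟩ 1 : Fin s → ℕ) else 0) +
        (if h : (p.2 : ℕ) < s then (Pi.single ⟨p.2, h⟩ 1 : Fin s → ℕ) else 0))).card :=
        Finset.card_le_card fun μ hμ => mem_image_pairs_of_sum_le_two μ (hdeg μ hμ)
    _ ≤ (Finset.univ : Finset (Fin (s + 1) × Fin (s + 1))).card := Finset.card_image_le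
    _ = (s + 1) ^ 2 := by simp [sq]
    _ ≤ (s + 2) ^ 2 := Nat.pow_le_pow_left (by omega) 2

end Summit.ValiantsHypothesis.ValiantsHypothesis.Theorems.NewtonUnitEquations.TwoProducts.FormalLogLinearisation

end
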